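import Summits.CriticalPhenomena.PercolationContinuityZ3.Theorems.PercNearOneGluingNoHeavyLowerTailLinearModulus

/-!
# `NoHeavyLowerTail` (stmt-CriticalPhenomena-4575): the explicit linear modulus is ADDITIVELY STABLE under a defective
# additive gluing inequality (tolerance pass-through, constant 1)

Effectivity audit (lane prim-rate, seat audit-3, gen 48), deliverable (b) «what an APPROXIMATE substitute costs» (HOME/SUBSTITUTES.md
§TOL); support file (helper) for the closed crux `NoHeavyLowerTail`.  No definitions, no sorries, standard axioms.
The side-branch crux `NoHeavyLowerTail` (audit row C6* / A3.31) is ADDITIVELY STABLE with constant 1: the seat's own p305556 proof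
`noHeavyLowerTail_linear_of_additiveGluing` (T/…NoHeavyLowerTailLinearModulus.lean:42–113, δ = ε/4) VERBATIM with the hypothesis
`AdditiveGluing` replaced by an η-defective one (`μ(o ↔ A) − t − η ≤ μ(o ↔ b)`): the hub block (Markov, 2δ) is untouched, the gluing
piece becomes `P(o ↮ a₀) < 2δ + η`, so `P(1 ≤ N ∧ N < (ε/4)·EN/ε) < ε + η`.  Companion: `…QuantAdditiveGluingTransferDefect.lean`
(the additive-gluing transports and Kozma–Nitzan's Lemma 10 Step V under the same defective hypothesis: loss `6δ + η`); Conjecture 3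
itself follows from an η-defective additive gluing for every `ε > η` with `δ = (ε − η)/2` (as in `additiveGluingSuffices_proof`).
So every consumer of `AdditiveGluing` on this side of the chain passes an additive defect with constant 1.
[cite: KozmaNitzan2024, Conj. 1 (p. 3)]
-/

noncomputable section

namespace Summit.CriticalPhenomena.PercolationContinuityZ3.Theorems

namespace Defect

open MeasureTheory Set
open Literature.Probability.LatticeModels (prodBernoulli)
open Literature.Probability.Percolation (openConn BondConfig measurableSet_openConn_holds)
open scoped Classical BigOperators

/-- **`NoHeavyLowerTail`'s linear-modulus bound under an η-defective additive gluing**: if `η ≥ 0` and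
`P(o ↔ A) − t − η ≤ P(o ↔ b)` whenever `P(a ↔ b) ≥ 1 − t` for all `a ∈ A` (an η-defective `AdditiveGluing`), then at thresholds
`1 − ε/4` the lower-tail event satisfies `P(1 ≤ N ∧ N < (ε/4)·EN/ε) < ε + η` — the proof of
`noHeavyLowerTail_linear_of_additiveGluing` verbatim (hub block `2·(ε/4)` by Markov; gluing piece `P(o ↮ a₀) < 2·(ε/4) + η`).
[cite: KozmaNitzan2024, Conj. 1 (p. 3)] -/
theorem noHeavyLowerTail_linear_of_additiveGluingDefect {η : ℝ} (hη : 0 ≤ η)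
    (hAG : ∀ (n : ℕ) (w : Sym2 (Fin n) → unitInterval) (A : Finset (Fin n)) (o b : Fin n) (t : ℝ), 0 ≤ t →
      (∀ a ∈ A, 1 - t ≤ (prodBernoulli w).real (openConn a b)) →
      (prodBernoulli w).real (⋃ a ∈ A, openConn o a) - t - η ≤ (prodBernoulli w).real (openConn o b))
    (ε : ℝ) (hε : 0 < ε) (n : ℕ) (w : Sym2 (Fin n) → unitInterval) (A : Finset (Fin n)) (o : Fin n)
    (hH1 : 1 - ε / 4 < (prodBernoulli w).real (⋃ a ∈ A, openConn o a))
    (hH2 : ∀ a ∈ A, ∀ a' ∈ A, 1 - ε / 4 < (prodBernoulli w).real (openConn a a')) :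
    (prodBernoulli w).real {ω : BondConfig (Fin n) |
        1 ≤ (A.filter fun a => ω ∈ openConn o a).card ∧
        ((A.filter fun a => ω ∈ openConn o a).card : ℝ) <
          ε / 4 * (∑ a ∈ A, (prodBernoulli w).real (openConn o a)) / ε} < ε + η := by
  set δ : ℝ := ε / 4 with hδ_def
  have hδ0 : 0 < δ := by positivity
  -- empty relay set: the bad event is empty
  rcases A.eq_empty_or_nonempty with hA0 | hAne
  · subst hA0
    have hεη : 0 < ε + η := by linarith
    simp [hεη]
  obtain ⟨a₀, ha₀⟩ := hAne
  have hcard_pos : (0 : ℝ) < A.card := by exact_mod_cast Finset.card_pos.mpr ⟨a₀, ha₀⟩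
  -- the threshold `δ·EN/ε = EN/4 ≤ |A|/4 < |A|/2`
  set EN : ℝ := ∑ a ∈ A, (prodBernoulli w).real (openConn o a) with hEN_def
  have hEN1 : EN ≤ A.card := by
    calc EN ≤ ∑ a ∈ A, (1 : ℝ) := Finset.sum_le_sum fun a _ => measureReal_le_one
      _ = A.card := by simp
  have ht : δ * EN / ε ≤ (A.card : ℝ) / 2 := by
    have h1 : δ * EN / ε = EN / 4 := by
      rw [hδ_def]; field_simp
    rw [h1]
    linarith
  -- star budget at the hub: `P(a ↮ a₀) ≤ δ` for every `a ∈ A`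
  have hstar : ∀ a ∈ A, (prodBernoulli w).real (openConn a a₀)ᶜ ≤ δ := by
    intro a ha
    rw [probReal_compl_eq_one_sub (measurableSet_openConn_holds a a₀)]
    linarith [hH2 a ha a₀ ha₀]
  -- piece 1: the hub block, by Markov (`nhlt_hubBlockMarkov`)
  have hB₁ : (prodBernoulli w).real {ω : BondConfig (Fin n) | ω ∈ openConn o a₀ ∧
      ((A.filter fun a => ω ∈ openConn o a).card : ℝ) < (A.card : ℝ) / 2} ≤ 2 * δ := by
    have h := nhlt_hubBlockMarkov n w A o a₀ ((A.card : ℝ) / 2) (by linarith)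
    have hsum : (∑ a ∈ A, (prodBernoulli w).real (openConn a a₀)ᶜ) ≤ A.card * δ := by
      calc (∑ a ∈ A, (prodBernoulli w).real (openConn a a₀)ᶜ) ≤ ∑ _a ∈ A, δ :=
            Finset.sum_le_sum fun a ha => hstar a ha
        _ = A.card * δ := by simp
    calc (prodBernoulli w).real {ω : BondConfig (Fin n) | ω ∈ openConn o a₀ ∧
          ((A.filter fun a => ω ∈ openConn o a).card : ℝ) < (A.card : ℝ) / 2}
        ≤ (∑ a ∈ A, (prodBernoulli w).real (openConn a a₀)ᶜ) / (A.card - A.card / 2) := h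
      _ ≤ (A.card * δ) / (A.card - A.card / 2) := div_le_div_of_nonneg_right hsum (by linarith)
      _ = 2 * δ := by field_simp; ring
  -- piece 2: `P(o ↮ a₀) < 2δ` by additive gluing at `b := a₀` with slack `δ`
  have hB₂ : (prodBernoulli w).real (openConn o a₀ : Set (BondConfig (Fin n)))ᶜ < 2 * δ + η := by
    have hglue := hAG n w A o a₀ δ hδ0.le (fun a ha => by linarith [hH2 a ha a₀ ha₀])
    rw [probReal_compl_eq_one_sub (measurableSet_openConn_holds o a₀)]
    linarith
  -- the cover
  have hsub : {ω : BondConfig (Fin n) | 1 ≤ (A.filter fun a => ω ∈ openConn o a).card ∧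
      ((A.filter fun a => ω ∈ openConn o a).card : ℝ) < δ * EN / ε} ⊆
      {ω : BondConfig (Fin n) | ω ∈ openConn o a₀ ∧
        ((A.filter fun a => ω ∈ openConn o a).card : ℝ) < (A.card : ℝ) / 2} ∪
      (openConn o a₀ : Set (BondConfig (Fin n)))ᶜ := by
    intro ω hω
    by_cases hoa : ω ∈ openConn o a₀
    · exact Or.inl ⟨hoa, hω.2.trans_le ht⟩
    · exact Or.inr hoa
  calc (prodBernoulli w).real {ω : BondConfig (Fin n) |
          1 ≤ (A.filter fun a => ω ∈ openConn o a).card ∧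
          ((A.filter fun a => ω ∈ openConn o a).card : ℝ) < δ * EN / ε}
      ≤ (prodBernoulli w).real ({ω : BondConfig (Fin n) | ω ∈ openConn o a₀ ∧
          ((A.filter fun a => ω ∈ openConn o a).card : ℝ) < (A.card : ℝ) / 2} ∪
          (openConn o a₀ : Set (BondConfig (Fin n)))ᶜ) := measureReal_mono hsub
    _ ≤ (prodBernoulli w).real {ω : BondConfig (Fin n) | ω ∈ openConn o a₀ ∧
          ((A.filter fun a => ω ∈ openConn o a).card : ℝ) < (A.card : ℝ) / 2} +
        (prodBernoulli w).real (openConn o a₀ : Set (BondConfig (Fin n)))ᶜ := measureReal_union_le _ _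
    _ < 2 * δ + (2 * δ + η) := by linarith
    _ = ε + η := by rw [hδ_def]; ring

/- Consistency at `η = 0` (an `example`, not a declaration — its type IS the tree's
`noHeavyLowerTail_linear_of_additiveGluing`): the hypothesis is `AdditiveGluing` itself and the bound `< ε` comes back. -/
example
    (hA : Summit.CriticalPhenomena.PercolationContinuityZ3.Theses.PercNearOneGluing.AdditiveGluing)
    (ε : ℝ) (hε : 0 < ε) (n : ℕ) (w : Sym2 (Fin n) → unitInterval) (A : Finset (Fin n)) (o : Fin n)
    (hH1 : 1 - ε / 4 < (prodBernoulli w).real (⋃ a ∈ A, openConn o a))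
    (hH2 : ∀ a ∈ A, ∀ a' ∈ A, 1 - ε / 4 < (prodBernoulli w).real (openConn a a')) :
    (prodBernoulli w).real {ω : BondConfig (Fin n) |
        1 ≤ (A.filter fun a => ω ∈ openConn o a).card ∧
        ((A.filter fun a => ω ∈ openConn o a).card : ℝ) <
          ε / 4 * (∑ a ∈ A, (prodBernoulli w).real (openConn o a)) / ε} < ε := by
  have h := noHeavyLowerTail_linear_of_additiveGluingDefect (η := 0) le_rfl
    (fun n w A o b t ht hab => by have := hA n w A o b t ht hab; linarith) ε hε n w A o hH1 hH2
  simpa using h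

end Defect

end Summit.CriticalPhenomena.PercolationContinuityZ3.Theorems

end
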